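import Literature.AlgebraicGeometry.Motives.ComplexPointsManifold
import Literature.NumberTheory.Transcendental.AnalytificationExistenceProofs
import Literature.Geometry.Kaehler.Kaehler
import Literature.Topology.FourManifolds.ComplexProjectiveSpaceOrientationProofs
import Literature.Topology.FourManifolds.IntersectionLatticeOrientationProofs
import Literature.Topology.FourManifolds.Recharted
import Literature.AlgebraicTopology.SingularHomology.OrientationProofs
import Literature.AlgebraicTopology.SingularHomology.PoincareDualityClosed
import Literature.AlgebraicTopology.SingularHomology.PoincareDualityCorollaries
import HarnessLib

/-!
# The complex orientation of `X(ℂ)`; Poincaré duality and the symmetry of Betti numbers for smooth projective complex varieties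

Family `hodge`, layer `Literature/AlgebraicGeometry/Motives`. The tree's duality statements on the
complex points `X(ℂ)` of a smooth projective complex variety (`ComplexPoints.bijective_poincareDualityMap_of`,
`HodgeTheory/ComplexGysin.OrientationFamily`, `Motives.BettiCycleData.orientation`, …) take the
orientation `μ_X` of the closed `2n`-manifold `X(ℂ)` as a DATUM or a hypothesis ("Not here: the
complex orientation of `X(ℂ)` for a general smooth projective `X`", module docstring of
`ProjectiveSpaceComplexPointsOrientation`, which supplies it for `X = ℙᴺ` only). This file
constructs it for every smooth separated `X` locally of finite type over `ℂ`, by assembling PROVED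
results of the tree:

* `det_tangentCoordChange_pos_of_isManifold_complex`, `isOrientable_of_isManifold_complex` —
  **every complex manifold is orientable** (Milnor–Stasheff §13, p. 151: "every complex manifold
  has a preferred orientation"; Huybrechts, Cor. 1.2.3; Boggess §2.5): the change of holomorphic
  charts has real Jacobian the realification of its complex Jacobian, of determinant
  `|det_ℂ|² ≥ 0` (the tree's `det_restrictScalars_nonneg`), and `≠ 0` for a chart change
  (`det_tangentCoordChange_ne_zero`); so the constant family of orientations of the model space is
  a `SmoothOrientation` of the underlying real `C^∞` manifold
  (`Literature.Geometry.Kaehler.isManifold_real_of_isManifold_complex`).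
* `ComplexPoints.isOrientableOver_int` — **`X(ℂ)` is `ℤ`-orientable in dimension `2n`** for `X`
  smooth of relative dimension `n`, separated and locally of finite type over `ℂ`: Serre's
  analytification `φ : X^an → X(ℂ)` (GAGA §2; the tree's `exists_isAnalytification_holds`) is a
  complex manifold charted on `ℂⁿ`, re-charted on `ℝ²ⁿ` (`Literature.Topology.FourManifolds.Recharted`,
  `SmoothOrientation.recharted`), smoothly oriented by the previous item, hence homologically
  `ℤ`-oriented (Bredon VI.7.15 / Milnor–Stasheff App. A; the tree's
  `isOrientableOver_int_of_isOrientable_holds`), and the orientation is transported along the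
  homeomorphism `φ` (`HomologicalOrientation.comap`); `ComplexPoints.isOrientableOver` is the
  `R`-orientability for every ring `R` (Hatcher p. 235, `HomologicalOrientation.toCoeff`) of a
  smooth projective `X`. (Everything here is a theorem; a chosen orientation is
  `Classical.choice (ComplexPoints.isOrientableOver_int X)`.)
* `ComplexPoints.bijective_poincareDualityMap_of_isSmoothProjective` — **Poincaré duality for
  `X(ℂ)`, unconditionally**
  (`X` smooth projective of dimension `n ≥ 1`, any `R`-orientation, `p + q = 2n`; Hatcher
  Thm. 3.30, the tree's PROVED `bijective_poincareDualityMap_of_one_le`).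
* `ComplexPoints.bettiNumber_eq_of_add_eq`, `ComplexPoints.finrank_singularCohomology_eq_of_add_eq`
  — **symmetry of the Betti numbers `b_p(X(ℂ); K) = b_q(X(ℂ); K)`, `p + q = 2n`**, for every field
  `K` (Hatcher Cor. 3.37; the tree's PROVED `bettiNumber_eq_bettiNumber_of_add_eq_holds` and
  `finrank_singularCohomology_eq_bettiNumber_of_field`).

Which of the two orientations of a connected `X(ℂ)` is "the complex one" is not tracked (the
duality statements do not depend on it). Motivation: the Poincaré-duality half of the Betti-number
bookkeeping `b_k(Y) = b_{2 dim Y - k}(Y)` for smooth hypersurface sections `Y`, an input of the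
growth step of Brosnan–Fang–Nie–Pearlstein 2009, Prop. 43
(`HodgeTheory/VanishingCohomologyNontrivialProofs`).

## References

* [MilnorStasheff1974] J. Milnor, J. Stasheff, Characteristic Classes (1974), §13 p. 151 and
  Appendix A.
* [HuybrechtsCG2005] D. Huybrechts, Complex Geometry (2005), Cor. 1.2.3 and §2.1.
* [HatcherAT2002] A. Hatcher, Algebraic Topology (2002), §3.3 p. 235, Thm. 3.30, Cor. 3.37.
* [SerreGAGA1956] J.-P. Serre, GAGA, Ann. Inst. Fourier 6 (1956), §2 n°5 Prop. 2.
-/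

noncomputable section

open scoped Manifold ContDiff Topology
open Set Module AlgebraicGeometry

namespace Literature.AlgebraicGeometry.Motives

open Literature.AlgebraicTopology.SingularHomology Literature.Topology.FourManifolds
  Literature.NumberTheory.Transcendental

universe u v

/-! ### Complex manifolds are orientable -/

section ComplexManifold

variable {E : Type*} [NormedAddCommGroup E] [NormedSpace ℂ E] [FiniteDimensional ℂ E]
  {M : Type*} [TopologicalSpace M] [ChartedSpace E M] [IsManifold 𝓘(ℂ, E) ω M]

/-- **The chart changes of a complex manifold have real Jacobians of positive determinant.** For
`y` in the domain of the preferred chart at `x`, the tangent coordinate change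
`tangentCoordChange 𝓘(ℝ, E) y x y` of the underlying real manifold is the realification of the
complex derivative of the holomorphic chart change, so its determinant is `|det_ℂ|² ≥ 0`
(`det_restrictScalars_nonneg`), and it is non-zero for a chart change
(`det_tangentCoordChange_ne_zero`). Boggess, *CR Manifolds*, §2.5 ("`χ ∘ 𝒴⁻¹` is orientation
preserving for any holomorphic coordinate charts"); Huybrechts Cor. 1.2.3.
[cite: HuybrechtsCG2005, Cor. 1.2.3] [cite: MilnorStasheff1974, §13 p. 151] -/
theorem det_tangentCoordChange_pos_of_isManifold_complex [IsManifold 𝓘(ℝ, E) 1 M] {x y : M}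
    (hy : y ∈ (chartAt E x).source) :
    0 < LinearMap.det ((tangentCoordChange 𝓘(ℝ, E) y x y : E →L[ℝ] E) : E →ₗ[ℝ] E) := by
  have hy' : y ∈ (extChartAt 𝓘(ℝ, E) y).source ∩ (extChartAt 𝓘(ℝ, E) x).source :=
    ⟨mem_extChartAt_source y, by rwa [extChartAt_source]⟩
  refine lt_of_le_of_ne ?_ (det_tangentCoordChange_ne_zero hy').symm
  -- the holomorphic chart change `τ = chart_x ∘ chart_y⁻¹` around `p = chart_y y`
  set τ : E → E := (chartAt E x) ∘ (chartAt E y).symm with hτ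
  set p : E := chartAt E y y with hp
  have hsrc : p ∈ ((chartAt E y).symm ≫ₕ chartAt E x).source := by
    refine ⟨(chartAt E y).map_source (mem_chart_source E y), ?_⟩
    show (chartAt E y).symm p ∈ (chartAt E x).source
    rw [hp, (chartAt E y).left_inv (mem_chart_source E y)]
    exact hy
  have hC : ContDiffOn ℂ ω τ ((chartAt E y).symm ≫ₕ chartAt E x).source := by
    have h := contDiffOn_ext_coord_change (I := 𝓘(ℂ, E)) (n := ω) x y
    rw [ext_coord_change_source] at h
    simpa only [extChartAt_coe, extChartAt_coe_symm, modelWithCornersSelf_coe,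
      modelWithCornersSelf_coe_symm, Set.image_id, Function.id_comp, Function.comp_id] using h
  have hdiff : DifferentiableAt ℂ τ p :=
    (hC.differentiableOn (by simp)).differentiableAt
      ((OpenPartialHomeomorph.open_source _).mem_nhds hsrc)
  -- its real derivative is the realification of the complex one
  have hderiv : HasFDerivAt τ ((fderiv ℂ τ p).restrictScalars ℝ) p :=
    hdiff.hasFDerivAt.restrictScalars ℝ
  have hT : tangentCoordChange 𝓘(ℝ, E) y x y = (fderiv ℂ τ p).restrictScalars ℝ := by
    rw [tangentCoordChange_def]
    simp only [extChartAt_coe, extChartAt_coe_symm, modelWithCornersSelf_coe,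
      modelWithCornersSelf_coe_symm, range_id, fderivWithin_univ, Function.id_comp,
      Function.comp_id]
    exact hderiv.fderiv
  rw [hT]
  exact det_restrictScalars_nonneg (fderiv ℂ τ p : E →ₗ[ℂ] E)

/-- **Every complex manifold is orientable** (Milnor–Stasheff §13, p. 151: "every complex
manifold has a preferred orientation"; Huybrechts Cor. 1.2.3; Boggess §2.5): on the real `C¹`
manifold underlying a complex manifold charted on the finite-dimensional complex space `E`
(`Literature.Geometry.Kaehler.isManifold_real_of_isManifold_complex`), the constant family of a
fixed orientation of the real vector space `E` is a smooth orientation, all chart changes having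
Jacobians of positive determinant (`det_tangentCoordChange_pos_of_isManifold_complex`).
[cite: MilnorStasheff1974, §13 p. 151] [cite: HuybrechtsCG2005, Cor. 1.2.3] -/
theorem isOrientable_of_isManifold_complex [IsManifold 𝓘(ℝ, E) 1 M] : IsOrientable 𝓘(ℝ, E) M := by
  refine ⟨{ toFun := fun _ ↦ (finBasis ℝ E).orientation, eventually_eq_iff' := fun x ↦ ?_ }⟩
  filter_upwards [chart_source_mem_nhds E x] with y hy
  simp only [true_iff]
  exact det_tangentCoordChange_pos_of_isManifold_complex hy

end ComplexManifold

/-! ### The complex orientation of `X(ℂ)` -/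

namespace ComplexPoints

variable {n : ℕ} (X : SchemeOver ℂ)

/-- **`X(ℂ)` is `ℤ`-orientable in dimension `2n`** for `X` smooth of relative dimension `n`,
separated and locally of finite type over `ℂ` (Milnor–Stasheff §13 p. 151 and App. A; Voisin I
§11.1.2: "a complex manifold is canonically oriented"): the analytification `φ : X^an → X(ℂ)`
(Serre, GAGA §2 n°5 Prop. 2; the tree's `exists_isAnalytification_holds`) is a complex manifold
charted on `ℂⁿ`; re-charted on `ℝ²ⁿ` (`Recharted`) it is smoothly oriented
(`isOrientable_of_isManifold_complex`, `SmoothOrientation.recharted`), hence `ℤ`-oriented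
(`isOrientableOver_int_of_isOrientable_holds`), and the orientation is transported along the
homeomorphism `X(ℂ) ≃ₜ X^an` (`HomologicalOrientation.comap`).
[cite: MilnorStasheff1974, §13 p. 151 and Appendix A] [cite: SerreGAGA1956, §2 n°5 Prop. 2] -/
theorem isOrientableOver_int [LocallyOfFiniteType X.hom] [SmoothOfRelativeDimension n X.hom]
    [IsSeparated X.hom] : IsOrientableOver ℤ (ComplexPoints X) (2 * n) := by
  obtain ⟨M, _, _, _, _, φ, hφ⟩ := exists_isAnalytification_holds X n
  haveI : IsManifold 𝓘(ℝ, Fin n → ℂ) ∞ M :=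
    Literature.Geometry.Kaehler.isManifold_real_of_isManifold_complex
  have hM : IsOrientable 𝓘(ℝ, Fin n → ℂ) M := isOrientable_of_isManifold_complex
  let L : (Fin n → ℂ) ≃L[ℝ] EuclideanSpace ℝ (Fin (2 * n)) :=
    ContinuousLinearEquiv.ofFinrankEq (by
      rw [finrank_pi_fintype, finrank_euclideanSpace_fin]
      simp [Complex.finrank_real_complex, mul_comm])
  have hR : IsOrientable (𝓡 (2 * n)) (Recharted M L) := ⟨(Classical.choice hM).recharted L⟩
  obtain ⟨μ⟩ := isOrientableOver_int_of_isOrientable_holds (Recharted M L) hR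
  exact ⟨μ.comap (hφ.homeomorph.symm.trans (Recharted.ofHomeomorph L))⟩

variable {X}

/-- **`X(ℂ)` is `R`-orientable for every commutative ring `R`**, `X` smooth projective of
dimension `n` ("an orientable manifold is `R`-orientable for all `R`", Hatcher p. 235,
`μₓ ↦ μₓ ⊗ 1`: the tree's `HomologicalOrientation.toCoeff` applied to a `ℤ`-orientation from
`isOrientableOver_int`).
[cite: HatcherAT2002, §3.3 p. 235] -/
theorem isOrientableOver (R : Type v) [CommRing R] (hX : IsSmoothProjective n X) :
    IsOrientableOver R (ComplexPoints X) (2 * n) := by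
  haveI : IsProper X.hom := IsSmoothProjective.isProper_holds hX
  haveI := hX.smoothOfRelativeDimension
  letI := hX.chartedSpace
  haveI := ComplexPoints.t2Space_of_isSmoothProjective hX
  exact ⟨(Classical.choice (isOrientableOver_int X)).toCoeff R⟩

/-- **Poincaré duality for `X(ℂ)`, unconditionally**: for `X` smooth projective of dimension
`n ≥ 1`, every `R`-orientation `μ` of `X(ℂ)` and `p + q = 2n`, the duality map
`Hᵖ(X(ℂ); R) → H_q(X(ℂ); R)`, `a ↦ a ⌢ [X(ℂ)]_μ`, is bijective — Hatcher Thm. 3.30 for the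
compact Hausdorff `2n`-manifold `X(ℂ)` (`IsSmoothProjective.chartedSpace`), the tree's PROVED
`bijective_poincareDualityMap_of_one_le`; orientations exist by `ComplexPoints.isOrientableOver`.
[cite: HatcherAT2002, §3.3 Thm. 3.30] -/
theorem bijective_poincareDualityMap_of_isSmoothProjective {R : Type} [CommRing R]
    (hX : IsSmoothProjective n X)
    (hn : 1 ≤ n) (μ : HomologicalOrientation R (ComplexPoints X) (2 * n)) {p q : ℕ}
    (h : p + q = 2 * n) : Function.Bijective (poincareDualityMap μ h) := by
  letI := hX.chartedSpace
  haveI := ComplexPoints.compactSpace_of_isSmoothProjective hX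
  haveI := ComplexPoints.t2Space_of_isSmoothProjective hX
  exact bijective_poincareDualityMap_of_one_le (by omega) μ h

/-- **Symmetry of the Betti numbers of a smooth projective complex variety**: for `X` smooth
projective of dimension `n`, a field `K` and `p + q = 2n`, `b_p(X(ℂ); K) = b_q(X(ℂ); K)`
(Hatcher Cor. 3.37 for the closed `K`-oriented `2n`-manifold `X(ℂ)`: the tree's PROVED
`bettiNumber_eq_bettiNumber_of_add_eq_holds`, with the orientation of `isOrientableOver`).
[cite: HatcherAT2002, §3.3 Cor. 3.37] -/
theorem bettiNumber_eq_of_add_eq (K : Type) [Field K] (hX : IsSmoothProjective n X) {p q : ℕ}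
    (h : p + q = 2 * n) : bettiNumber K (ComplexPoints X) p = bettiNumber K (ComplexPoints X) q := by
  letI := hX.chartedSpace
  haveI := ComplexPoints.compactSpace_of_isSmoothProjective hX
  haveI := ComplexPoints.t2Space_of_isSmoothProjective hX
  exact bettiNumber_eq_bettiNumber_of_add_eq_holds (K := K) (X := ComplexPoints X) (n := 2 * n)
    (isOrientableOver K hX) h

/-- **Symmetry of the Betti numbers, cohomological form**: for `X` smooth projective of
dimension `n`, a field `K` and `p + q = 2n`, `dim_K Hᵖ(X(ℂ); K) = dim_K H^q(X(ℂ); K)`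
(`bettiNumber_eq_of_add_eq` and universal coefficients over a field,
`finrank_singularCohomology_eq_bettiNumber_of_field`). [cite: HatcherAT2002, §3.3 Cor. 3.37] -/
theorem finrank_singularCohomology_eq_of_add_eq (K : Type) [Field K] (hX : IsSmoothProjective n X)
    {p q : ℕ} (h : p + q = 2 * n) :
    finrank K (singularCohomology K K (ComplexPoints X) p) =
      finrank K (singularCohomology K K (ComplexPoints X) q) := by
  rw [finrank_singularCohomology_eq_bettiNumber_of_field,
    finrank_singularCohomology_eq_bettiNumber_of_field, bettiNumber_eq_of_add_eq K hX h]

end ComplexPoints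

end Literature.AlgebraicGeometry.Motives

end
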